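import Mathlib
import Summits.NavierStokesRegularity.NavierStokesRegularity.Theorems.EulerZoomLiouvillePowerGaugeEulerLiouvilleSelfSimilarHomogeneousTail
import Summits.NavierStokesRegularity.NavierStokesRegularity.Theorems.EulerZoomLiouvillePowerGaugeEulerLiouvilleSelfSimilarLpProfile
import HarnessLib

/-!
# Dyadic shell bookkeeping for weak self-similar profiles with a dyadically homogeneous tail
# (tools for Chae–Shvydkoy 2013, Thm 4.2, inside Seregin's class)

Route №10 `EulerZoomLiouville` (NavierStokesRegularity), crux E = stmt-NavierStokesRegularity-19832,
registered open stub `stub_selfSimilarWeakRest`.  Measure-theoretic tools for the sequel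
`…SelfSimilarWeakHomogeneousTail` (CS13 Thm 4.2 (i)–(ii) in the weak class), with the dyadic shells
`S_k = {2^k R₀ ≤ |y| < 2^{k+1} R₀}` of the tree's `…SelfSimilarHomogeneousTail`:

* `WeakTail.lintegral_shell_succ_of_dyadicHomogeneous`, `…_eq_of_dyadicHomogeneous_rpow` — under
  the DYADIC homogeneity `V(2y) = 2^{−β} V(y)` (`|y| ≥ R₀ > 0`, any real `β`):
  `∫_{S_k} ‖V‖² = 2^{k(3−2β)} ∫_{S_0} ‖V‖²` (change of variables; the tree's lemma is `β = 3/2`);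
* `WeakTail.lintegral_ball_le_add_sum_shells` — `∫_{B_{2^K R₀}} ‖V‖² ≤ ∫_{B_{R₀}} ‖V‖² + Σ_{k<K} ∫_{S_k} ‖V‖²`;
* `WeakTail.lintegral_tail_eq_tsum_shells` — `∫_{|y| ≥ R₀} ‖V‖² = Σ_k ∫_{S_k} ‖V‖²`;
* `WeakTail.subExtremal_of_tail_ae_zero` — a NULL tail makes the profile sub-extremal for `ρ < 1/2`
  (`L^{2ρ−1} ∫_{B_L}‖V‖² ≤ L^{2ρ−1} ∫_{B_{R₀}}‖V‖² → 0`), in the `hsub` shape of the fillers;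
* `WeakTail.tendsto_two_rpow_neg_mul` — `2^{−ak} → 0`.

WHAT THIS IS NOT: not NS, not E — bookkeeping. [folklore; cf. ChaeShvydkoy2013 §4.1]
-/

noncomputable section

-- flat `Theorems/<Route><Decl>…` files of one crux share the namespace of the crux (tree convention)
set_option linter.dupNamespace false

open MeasureTheory Set Filter Topology Metric Function TopologicalSpace Finset
open scoped ENNReal NNReal

namespace Summit.NavierStokesRegularity.NavierStokesRegularity.Theorems.PowerGaugeEulerLiouville

open Literature.Analysis Literature.Analysis.FunctionSpaces Literature.Analysis.FluidPDE

namespace WeakTail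

section Shells

variable {V : EuclideanSpace ℝ (Fin 3) → EuclideanSpace ℝ (Fin 3)} {R₀ β : ℝ}

/-- **Dyadic scale covariance of the shell energies, general degree.**  If `V(2y) = 2^{−β} V(y)` for
`|y| ≥ R₀` (`R₀ > 0`), then `∫_{S_{k+1}} ‖V‖² = 2^{3−2β} ∫_{S_k} ‖V‖²` for the dyadic shells
`S_k = {2^k R₀ ≤ |y| < 2^{k+1} R₀}` (change of variables `y = 2y'`).  The tree's
`lintegral_shell_eq_of_dyadicHomogeneous` is `β = 3/2`. [cite: ChaeShvydkoy2013, §4.1 proof of Thm. 4.2] -/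
theorem lintegral_shell_succ_of_dyadicHomogeneous (hR₀ : 0 < R₀)
    (hhom : ∀ y : EuclideanSpace ℝ (Fin 3), R₀ ≤ ‖y‖ →
      V ((2 : ℝ) • y) = ((2 : ℝ) ^ (-β)) • V y) (k : ℕ) :
    ∫⁻ y in {y : EuclideanSpace ℝ (Fin 3) | (2 : ℝ) ^ (k + 1) * R₀ ≤ ‖y‖ ∧ ‖y‖ < (2 : ℝ) ^ (k + 1 + 1) * R₀},
        ‖V y‖ₑ ^ 2 =
      ENNReal.ofReal ((2 : ℝ) ^ (3 - 2 * β)) *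
        ∫⁻ y in {y : EuclideanSpace ℝ (Fin 3) | (2 : ℝ) ^ k * R₀ ≤ ‖y‖ ∧ ‖y‖ < (2 : ℝ) ^ (k + 1) * R₀},
          ‖V y‖ₑ ^ 2 := by
  -- adapted from the tree's `lintegral_shell_eq_of_dyadicHomogeneous` (β = 3/2)
  have key := Tsai2021.lintegral_comp_smul_set (fun y : EuclideanSpace ℝ (Fin 3) => ‖V y‖ₑ ^ 2)
    (by norm_num : (0 : ℝ) < 2) (measurableSet_dyadicShell R₀ k)
  rw [smul_dyadicShell] at key
  have hhom' : ∀ y ∈ {y : EuclideanSpace ℝ (Fin 3) | (2 : ℝ) ^ k * R₀ ≤ ‖y‖ ∧ ‖y‖ < (2 : ℝ) ^ (k + 1) * R₀},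
      ‖V ((2 : ℝ) • y)‖ₑ ^ 2 = ENNReal.ofReal ((2 : ℝ) ^ (-(2 * β))) * ‖V y‖ₑ ^ 2 := by
    intro y hy
    have hy' : R₀ ≤ ‖y‖ := le_trans (le_mul_of_one_le_left hR₀.le (one_le_pow₀ (by norm_num))) hy.1
    rw [hhom y hy', enorm_smul, mul_pow, Real.enorm_eq_ofReal (by positivity),
      ← ENNReal.ofReal_pow (by positivity), ← Real.rpow_natCast, ← Real.rpow_mul (by norm_num)]
    congr 2
    push_cast
    ring
  rw [setLIntegral_congr_fun (measurableSet_dyadicShell R₀ k) hhom',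
    lintegral_const_mul' _ _ ENNReal.ofReal_ne_top] at key
  -- `key : ofReal (2^{-2β}) * ∫_{S_k} = ofReal (1/8) * ∫_{S_{k+1}}`
  have h8 : ENNReal.ofReal (((2 : ℝ) ^ 3)⁻¹) ≠ 0 := by
    rw [ENNReal.ofReal_ne_zero_iff]; positivity
  have h8' : ENNReal.ofReal ((2 : ℝ) ^ 3) * ENNReal.ofReal (((2 : ℝ) ^ 3)⁻¹) = 1 := by
    rw [← ENNReal.ofReal_mul (by positivity), mul_inv_cancel₀ (by positivity), ENNReal.ofReal_one]
  calc ∫⁻ y in {y : EuclideanSpace ℝ (Fin 3) | (2 : ℝ) ^ (k + 1) * R₀ ≤ ‖y‖ ∧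
          ‖y‖ < (2 : ℝ) ^ (k + 1 + 1) * R₀}, ‖V y‖ₑ ^ 2
      = ENNReal.ofReal ((2 : ℝ) ^ 3) * (ENNReal.ofReal (((2 : ℝ) ^ 3)⁻¹) *
          ∫⁻ y in {y : EuclideanSpace ℝ (Fin 3) | (2 : ℝ) ^ (k + 1) * R₀ ≤ ‖y‖ ∧
            ‖y‖ < (2 : ℝ) ^ (k + 1 + 1) * R₀}, ‖V y‖ₑ ^ 2) := by
        rw [← mul_assoc, h8', one_mul]
    _ = ENNReal.ofReal ((2 : ℝ) ^ 3) * (ENNReal.ofReal ((2 : ℝ) ^ (-(2 * β))) *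
          ∫⁻ y in {y : EuclideanSpace ℝ (Fin 3) | (2 : ℝ) ^ k * R₀ ≤ ‖y‖ ∧ ‖y‖ < (2 : ℝ) ^ (k + 1) * R₀},
            ‖V y‖ₑ ^ 2) := by rw [key]
    _ = ENNReal.ofReal ((2 : ℝ) ^ (3 - 2 * β)) *
          ∫⁻ y in {y : EuclideanSpace ℝ (Fin 3) | (2 : ℝ) ^ k * R₀ ≤ ‖y‖ ∧ ‖y‖ < (2 : ℝ) ^ (k + 1) * R₀},
            ‖V y‖ₑ ^ 2 := by
        rw [← mul_assoc, ← ENNReal.ofReal_mul (by positivity)]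
        congr 2
        rw [show (3 : ℝ) - 2 * β = 3 + -(2 * β) by ring, Real.rpow_add (by norm_num : (0 : ℝ) < 2),
          show (3 : ℝ) = ((3 : ℕ) : ℝ) by norm_num, Real.rpow_natCast]

/-- The `k`-th dyadic shell energy is `2^{k(3−2β)}` times the first one. [cite: ChaeShvydkoy2013, §4.1 proof of Thm. 4.2] -/
theorem lintegral_shell_eq_of_dyadicHomogeneous_rpow (hR₀ : 0 < R₀)
    (hhom : ∀ y : EuclideanSpace ℝ (Fin 3), R₀ ≤ ‖y‖ →
      V ((2 : ℝ) • y) = ((2 : ℝ) ^ (-β)) • V y) (k : ℕ) :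
    ∫⁻ y in {y : EuclideanSpace ℝ (Fin 3) | (2 : ℝ) ^ k * R₀ ≤ ‖y‖ ∧ ‖y‖ < (2 : ℝ) ^ (k + 1) * R₀},
        ‖V y‖ₑ ^ 2 =
      ENNReal.ofReal ((2 : ℝ) ^ ((3 - 2 * β) * k)) *
        ∫⁻ y in {y : EuclideanSpace ℝ (Fin 3) | R₀ ≤ ‖y‖ ∧ ‖y‖ < 2 * R₀}, ‖V y‖ₑ ^ 2 := by
  induction k with
  | zero => simp
  | succ k ih =>
    rw [lintegral_shell_succ_of_dyadicHomogeneous hR₀ hhom k, ih, ← mul_assoc,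
      ← ENNReal.ofReal_mul (by positivity), ← Real.rpow_add (by norm_num : (0 : ℝ) < 2)]
    congr 3
    push_cast
    ring

/-- The ball `B_{2^{K} R₀}` is covered by `B_{R₀}` and the first `K` dyadic shells, so its energy is at
most `∫_{B_{R₀}} ‖V‖² + Σ_{k<K} ∫_{S_k} ‖V‖²`. [folklore] -/
theorem lintegral_ball_le_add_sum_shells (R₀ : ℝ) (K : ℕ) :
    ∫⁻ y in ball (0 : EuclideanSpace ℝ (Fin 3)) ((2 : ℝ) ^ K * R₀), ‖V y‖ₑ ^ 2 ≤
      (∫⁻ y in ball (0 : EuclideanSpace ℝ (Fin 3)) R₀, ‖V y‖ₑ ^ 2) +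
        ∑ k ∈ Finset.range K,
          ∫⁻ y in {y : EuclideanSpace ℝ (Fin 3) | (2 : ℝ) ^ k * R₀ ≤ ‖y‖ ∧ ‖y‖ < (2 : ℝ) ^ (k + 1) * R₀},
            ‖V y‖ₑ ^ 2 := by
  induction K with
  | zero => simp
  | succ K ih =>
    have hsub : ball (0 : EuclideanSpace ℝ (Fin 3)) ((2 : ℝ) ^ (K + 1) * R₀) ⊆
        ball (0 : EuclideanSpace ℝ (Fin 3)) ((2 : ℝ) ^ K * R₀) ∪
          {y : EuclideanSpace ℝ (Fin 3) | (2 : ℝ) ^ K * R₀ ≤ ‖y‖ ∧ ‖y‖ < (2 : ℝ) ^ (K + 1) * R₀} := by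
      intro y hy
      rw [mem_ball, dist_zero_right] at hy
      by_cases h : ‖y‖ < (2 : ℝ) ^ K * R₀
      · exact Or.inl (by rw [mem_ball, dist_zero_right]; exact h)
      · exact Or.inr ⟨not_lt.1 h, hy⟩
    calc ∫⁻ y in ball (0 : EuclideanSpace ℝ (Fin 3)) ((2 : ℝ) ^ (K + 1) * R₀), ‖V y‖ₑ ^ 2
        ≤ ∫⁻ y in ball (0 : EuclideanSpace ℝ (Fin 3)) ((2 : ℝ) ^ K * R₀) ∪
            {y : EuclideanSpace ℝ (Fin 3) | (2 : ℝ) ^ K * R₀ ≤ ‖y‖ ∧ ‖y‖ < (2 : ℝ) ^ (K + 1) * R₀},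
            ‖V y‖ₑ ^ 2 := lintegral_mono_set hsub
      _ ≤ (∫⁻ y in ball (0 : EuclideanSpace ℝ (Fin 3)) ((2 : ℝ) ^ K * R₀), ‖V y‖ₑ ^ 2) +
            ∫⁻ y in {y : EuclideanSpace ℝ (Fin 3) | (2 : ℝ) ^ K * R₀ ≤ ‖y‖ ∧ ‖y‖ < (2 : ℝ) ^ (K + 1) * R₀},
              ‖V y‖ₑ ^ 2 := lintegral_union_le _ _ _
      _ ≤ _ := by
        rw [Finset.sum_range_succ, ← add_assoc]
        exact add_le_add ih le_rfl

/-- **The tail `{|y| ≥ R₀}` is the disjoint union of the dyadic shells**: its energy is the sum of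
the shell energies. [folklore] -/
theorem lintegral_tail_eq_tsum_shells (hR₀ : 0 < R₀) :
    ∫⁻ y in {y : EuclideanSpace ℝ (Fin 3) | R₀ ≤ ‖y‖}, ‖V y‖ₑ ^ 2 =
      ∑' k : ℕ, ∫⁻ y in {y : EuclideanSpace ℝ (Fin 3) | (2 : ℝ) ^ k * R₀ ≤ ‖y‖ ∧ ‖y‖ < (2 : ℝ) ^ (k + 1) * R₀},
        ‖V y‖ₑ ^ 2 := by
  -- adapted from the tree's `ae_eq_zero_tail_of_dyadicHomogeneous`
  set S : ℕ → Set (EuclideanSpace ℝ (Fin 3)) := fun k =>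
    {y : EuclideanSpace ℝ (Fin 3) | (2 : ℝ) ^ k * R₀ ≤ ‖y‖ ∧ ‖y‖ < (2 : ℝ) ^ (k + 1) * R₀} with hS
  have hSm : ∀ k, MeasurableSet (S k) := fun k => measurableSet_dyadicShell R₀ k
  have hU : {y : EuclideanSpace ℝ (Fin 3) | R₀ ≤ ‖y‖} = ⋃ k, S k := by
    ext y
    simp only [mem_setOf_eq, mem_iUnion, hS]
    constructor
    · intro hy
      obtain ⟨k, hk1, hk2⟩ : ∃ k : ℕ, (2 : ℝ) ^ k ≤ ‖y‖ / R₀ ∧ ‖y‖ / R₀ < (2 : ℝ) ^ (k + 1) := by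
        have h1 : 1 ≤ ‖y‖ / R₀ := by rw [le_div_iff₀ hR₀]; linarith
        obtain ⟨k, hk⟩ := exists_nat_pow_near h1 (by norm_num : (1 : ℝ) < 2)
        exact ⟨k, hk⟩
      refine ⟨k, ?_, ?_⟩
      · rw [le_div_iff₀ hR₀] at hk1; linarith
      · rw [div_lt_iff₀ hR₀] at hk2; linarith
    · rintro ⟨k, hk1, -⟩
      exact le_trans (le_mul_of_one_le_left hR₀.le (one_le_pow₀ (by norm_num))) hk1
  have hdisj : Pairwise (Function.onFun Disjoint S) := by
    intro i j hij
    rw [Function.onFun, Set.disjoint_left]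
    intro y hyi hyj
    simp only [hS, mem_setOf_eq] at hyi hyj
    have h2 : (1 : ℝ) < 2 := by norm_num
    rcases lt_or_gt_of_ne hij with h | h
    · have : (2 : ℝ) ^ (i + 1) * R₀ ≤ (2 : ℝ) ^ j * R₀ :=
        mul_le_mul_of_nonneg_right (pow_le_pow_right₀ h2.le (by omega)) hR₀.le
      linarith [hyi.2, hyj.1]
    · have : (2 : ℝ) ^ (j + 1) * R₀ ≤ (2 : ℝ) ^ i * R₀ :=
        mul_le_mul_of_nonneg_right (pow_le_pow_right₀ h2.le (by omega)) hR₀.le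
      linarith [hyj.2, hyi.1]
  rw [hU, lintegral_iUnion hSm hdisj]

/-- **A null tail makes the profile sub-extremal (`ρ < 1/2`)**: if `V = 0` a.e. on `{|y| ≥ R₀}` and
`|V|² ∈ L¹_loc`, then `L^{2ρ−1} ∫_{B_L} ‖V‖² → 0`, in the `hsub` shape of the sub-extremal fillers.
[folklore] -/
theorem subExtremal_of_tail_ae_zero {ρ : ℝ} (hρ2 : ρ < 1 / 2)
    (hV2 : LocallyIntegrable (fun y => ‖V y‖ ^ 2) volume)
    (htail : ∫⁻ y in {y : EuclideanSpace ℝ (Fin 3) | R₀ ≤ ‖y‖}, ‖V y‖ₑ ^ 2 = 0) :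
    ∀ ε : ℝ, 0 < ε → ∀ L₀ : ℝ, ∃ L : ℝ, L₀ ≤ L ∧
      L ^ (2 * ρ - 1) * ∫ y in ball (0 : EuclideanSpace ℝ (Fin 3)) L, ‖V y‖ ^ 2 < ε := by
  intro ε hε L₀
  set X : ℝ≥0∞ := ∫⁻ y in ball (0 : EuclideanSpace ℝ (Fin 3)) R₀, ‖V y‖ₑ ^ 2 with hX
  have hXtop : X ≠ ⊤ := (LpProfile.lintegral_ball_sq_lt_top hV2 R₀).ne
  -- every ball energy is at most `X`
  have hball : ∀ L : ℝ, ∫⁻ y in ball (0 : EuclideanSpace ℝ (Fin 3)) L, ‖V y‖ₑ ^ 2 ≤ X := by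
    intro L
    have hsub : ball (0 : EuclideanSpace ℝ (Fin 3)) L ⊆
        ball (0 : EuclideanSpace ℝ (Fin 3)) R₀ ∪ {y | R₀ ≤ ‖y‖} := by
      intro y _
      by_cases h : ‖y‖ < R₀
      · exact Or.inl (by rw [mem_ball, dist_zero_right]; exact h)
      · exact Or.inr (not_lt.1 h)
    calc ∫⁻ y in ball (0 : EuclideanSpace ℝ (Fin 3)) L, ‖V y‖ₑ ^ 2
        ≤ ∫⁻ y in ball (0 : EuclideanSpace ℝ (Fin 3)) R₀ ∪ {y | R₀ ≤ ‖y‖}, ‖V y‖ₑ ^ 2 :=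
          lintegral_mono_set hsub
      _ ≤ X + ∫⁻ y in {y : EuclideanSpace ℝ (Fin 3) | R₀ ≤ ‖y‖}, ‖V y‖ₑ ^ 2 := lintegral_union_le _ _ _
      _ = X := by rw [htail, add_zero]
  have hXlim : Tendsto (fun L : ℝ => L ^ (2 * ρ - 1) * (X.toReal + 1)) atTop (𝓝 (0 * (X.toReal + 1))) := by
    refine Tendsto.mul_const _ ?_
    have := tendsto_rpow_neg_atTop (y := 1 - 2 * ρ) (by linarith)
    simpa [show -(1 - 2 * ρ) = 2 * ρ - 1 by ring] using this
  rw [zero_mul] at hXlim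
  obtain ⟨L, hLX, hLge⟩ := ((hXlim.eventually (gt_mem_nhds hε)).and (eventually_ge_atTop (max L₀ 1))).exists
  have hL0 : 0 < L := one_pos.trans_le ((le_max_right _ _).trans hLge)
  refine ⟨L, (le_max_left _ _).trans hLge, lt_of_le_of_lt ?_ hLX⟩
  rw [LpProfile.integral_ball_sq_eq_toReal hV2 L]
  refine mul_le_mul_of_nonneg_left ?_ (Real.rpow_nonneg hL0.le _)
  exact (ENNReal.toReal_mono hXtop (hball L)).trans (by linarith)

/-- `2^{−a k} → 0` as `k → ∞` (`a > 0`). [folklore] -/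
theorem tendsto_two_rpow_neg_mul {a : ℝ} (ha : 0 < a) :
    Tendsto (fun k : ℕ => (2 : ℝ) ^ (-(a * k))) atTop (𝓝 0) := by
  have h2a : (2 : ℝ) ^ (-a) < 1 := Real.rpow_lt_one_of_one_lt_of_neg (by norm_num) (by linarith)
  have h := tendsto_pow_atTop_nhds_zero_of_lt_one (Real.rpow_nonneg (by norm_num : (0:ℝ) ≤ 2) (-a)) h2a
  refine h.congr fun k => ?_
  rw [← Real.rpow_natCast, ← Real.rpow_mul (by norm_num : (0 : ℝ) ≤ 2)]
  congr 1
  ring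

end Shells

end WeakTail

end Summit.NavierStokesRegularity.NavierStokesRegularity.Theorems.PowerGaugeEulerLiouville

end
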